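import Literature.RepresentationTheory.FiniteGroups.DegreeZeroInduction
import Literature.RepresentationTheory.FiniteGroups.EquivOfCharacter
import Literature.RepresentationTheory.Semisimple.Multiplicity
import Mathlib.LinearAlgebra.Pi
import HarnessLib

/-!
# Degree-zero Brauer induction as an isomorphism of genuine representations

Topic `Literature/RepresentationTheory/FiniteGroups` (sequel of `DegreeZeroInduction`,
`MonomialRepresentation`, `EquivOfCharacter`).  Serre, *Linear Representations of Finite Groups*,
§10.5 Exercise 10.6 (proved in `DegreeZeroInduction`): for a character `χ` of a finite group `G`,
`χ - χ(1) = ∑ᵢ nᵢ · Ind_{Hᵢ}^G (αᵢ - 1)` with `nᵢ ∈ ℤ`, `αᵢ` characters of degree `1` of subgroups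
`Hᵢ`.  The consumer of this identity — the uniqueness of the Langlands–Deligne local constants
(Deligne, Antwerp II (1973), Thm. 4.1), where `ε` is multiplicative in direct sums but is only
defined on genuine representations — needs it as an **isomorphism of representations**: writing
`nᵢ = aᵢ - bᵢ` with `aᵢ, bᵢ ≥ 0` and moving the negative terms across,
`π ⊕ ⊕ᵢ (Ind 1_{Hᵢ})^{aᵢ} ⊕ ⊕ᵢ (Ind αᵢ)^{bᵢ} ≅ 1^{dim π} ⊕ ⊕ᵢ (Ind αᵢ)^{aᵢ} ⊕ ⊕ᵢ (Ind 1_{Hᵢ})^{bᵢ}`,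
since both sides have the same character (Serre §2.3 Cor. 2, `Representation.nonempty_equiv_of_character_eq`).
This file proves exactly this (`nonempty_equiv_of_character_sub_eq_sum`), with the `Ind`'s
realised by the monomial model `monomialRep` (`MonomialRepresentation`), together with the
bookkeeping it needs, all proved:

* `Representation.piOptionEquiv`, `Representation.piCongrLeftEquiv` — equivalences of the direct
  sum `Representation.pi` of a family (`Literature.RepresentationTheory.Semisimple.Multiplicity`)
  under `Option`-splitting and reindexing; `Representation.character_pi` — **the character of a
  finite direct sum is the sum of the characters** (Serre §2.1 Prop. 2);
* `sumMonomialRep H θ a = ⊕ᵢ (Ind_{Hᵢ} θᵢ)^{aᵢ}` (a `Representation.pi` over `Σ i, Fin (a i)`) and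
  `character_sumMonomialRep` (`= ∑ aᵢ Ind θᵢ`, Serre §3.3 Thm. 12 via `character_monomialRep`);
  `character_trivial_fun`;
* `monomialRep_conj_single`, `eq_top_of_forall_monomialRep_single_coe_mem` — in the monomial model
  the basis vector `e_{gH}` is an eigenvector of the conjugate subgroup `gHg⁻¹` (eigencharacter
  `θ^g`) whose translates span (Serre §3.3: `ρ_s W_σ = W_{sσ}`); used to recognise `Ind_H^G θ` as
  induced from any conjugate of `(H, θ)` (`InducedRecognition.nonempty_equiv_ind`).

## Mathlib search

Mathlib (this pin) has `Representation.prod`, `Representation.character`, `char_iso`,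
`LinearEquiv.piOptionEquivProd`, `LinearEquiv.piCongrLeft`, `Fintype.induction_empty_option`,
`Int.toNat_sub_toNat_neg`, used below; no induced characters, no Brauer theorem.  The tree supplies
`Representation.pi` (`Semisimple.Multiplicity`), `Representation.char_prod` and
`Representation.nonempty_equiv_of_character_eq` (`EquivOfCharacter`), `monomialRep`,
`character_monomialRep`, `indClassFun`, `exists_sum_indClassFun_sub_one_of_isCharacter`.
Nothing here duplicates an existing declaration.

## References

* J.-P. Serre, *Linear Representations of Finite Groups*, GTM 42 (1977), §2.1 Prop. 2, §2.3 Cor. 2,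
  §3.3 (Thm. 12), §10.5 Exercise 10.6 (`SerreLinearRepresentations1977`).
* P. Deligne, *Les constantes des équations fonctionnelles des fonctions L*, Antwerp II, LNM 349
  (1973), proof of Thm. 4.1 (context: why the isomorphism form is needed; `DeligneAntwerpII1973`).
-/

noncomputable section

open scoped BigOperators
open Module

namespace Literature.RepresentationTheory.FiniteGroups

open Literature.RepresentationTheory.Semisimple

/-! ### Direct sums of families: equivalences and characters -/

section Pi

universe u v w

variable {k : Type u} [Field k] {G : Type v} [Group G]

/-- `⊕_{j : Option ι} τ_j ≅ τ_none ⊕ ⊕_{i : ι} τ_{some i}` (Mathlib `LinearEquiv.piOptionEquivProd`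
is `G`-equivariant for the componentwise actions). [folklore] -/
def Representation.piOptionEquiv {ι : Type*} {C : Option ι → Type w} [∀ j, AddCommGroup (C j)]
    [∀ j, Module k (C j)] (τ : ∀ j, Representation k G (C j)) :
    (Representation.pi τ).Equiv ((τ none).prod (Representation.pi fun i => τ (some i))) :=
  Representation.Equiv.mk (LinearEquiv.piOptionEquivProd k) fun g => by
    refine LinearMap.ext fun v => Prod.ext rfl (funext fun i => rfl)

/-- Reindexing a direct sum along `e : ι' ≃ ι` (Mathlib `LinearEquiv.piCongrLeft`). [folklore] -/
def Representation.piCongrLeftEquiv {ι ι' : Type*} {C : ι → Type w} [∀ j, AddCommGroup (C j)]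
    [∀ j, Module k (C j)] (τ : ∀ j, Representation k G (C j)) (e : ι' ≃ ι) :
    (Representation.pi fun i' => τ (e i')).Equiv (Representation.pi τ) :=
  Representation.Equiv.mk (LinearEquiv.piCongrLeft k C e) fun g => by
    refine LinearMap.ext fun v => funext fun i => ?_
    -- transport along `i = e (e.symm i)`
    obtain ⟨a, rfl⟩ := e.surjective i
    change Equiv.piCongrLeft C e ((Representation.pi fun i' => τ (e i')) g v) (e a) =
      τ (e a) g (Equiv.piCongrLeft C e v (e a))
    rw [Equiv.piCongrLeft_apply_apply, Equiv.piCongrLeft_apply_apply,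
      Representation.pi_apply_apply]

/-- **The character of a finite direct sum is the sum of the characters**:
`χ_{⊕ τ_j} = ∑_j χ_{τ_j}` (induction on the index type through `piOptionEquiv`,
`Representation.char_prod` and invariance of characters under equivalence).
Ref: Serre, *Linear Representations*, §2.1 Prop. 2 (i). [cite: SerreLinearRepresentations1977, §2.1 Prop. 2] -/
theorem Representation.character_pi {ι : Type w} [Fintype ι] {C : ι → Type w}
    [∀ j, AddCommGroup (C j)] [∀ j, Module k (C j)] [∀ j, FiniteDimensional k (C j)]
    (τ : ∀ j, Representation k G (C j)) :
    (Representation.pi τ).character = ∑ j, (τ j).character := by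
  revert C
  refine Fintype.induction_empty_option (P := fun (α : Type w) [Fintype α] =>
    ∀ {C : α → Type w} [∀ j, AddCommGroup (C j)] [∀ j, Module k (C j)]
      [∀ j, FiniteDimensional k (C j)] (τ : ∀ j, Representation k G (C j)),
      (Representation.pi τ).character = ∑ j, (τ j).character) ?_ ?_ ?_ ι
  · intro α β _ e ih C _ _ _ τ
    letI : Fintype α := Fintype.ofEquiv β e.symm
    rw [← Representation.char_iso (Representation.piCongrLeftEquiv τ e), ih (fun a => τ (e a)),
      ← e.sum_comp]
  · intro C _ _ _ τ
    funext g
    rw [Fintype.sum_empty, Pi.zero_apply, Representation.character]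
    haveI : Subsingleton (∀ j : PEmpty, C j) := ⟨fun f g => funext fun j => j.elim⟩
    have h0 : Representation.pi τ g = 0 := LinearMap.ext fun v => Subsingleton.elim _ _
    rw [h0, map_zero]
  · intro α _ ih C _ _ _ τ
    rw [Representation.char_iso (Representation.piOptionEquiv τ), Representation.char_prod,
      ih (fun i => τ (some i)), Fintype.sum_option]

end Pi

/-! ### The monomial representation seen from an arbitrary coset -/

section Monomial

variable {k : Type*} [CommRing k] {G : Type*} [Group G] (H : Subgroup G) (θ : H →* kˣ)

/-- **`e_{gH}` is an eigenvector of `g H g⁻¹`**: `(g h g⁻¹) · e_{gH} = θ(h) e_{gH}` for `h ∈ H`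
(the line `k e_{gH}` is the copy of the conjugate character `θ^g` of `gHg⁻¹`; Serre §3.3,
`ρ_s W = W_{sσ}`). [cite: SerreLinearRepresentations1977, §3.3] -/
theorem monomialRep_conj_single [DecidableEq (G ⧸ H)] (g : G) (h : H) :
    monomialRep H θ (g * h * g⁻¹) (Pi.single (g : G ⧸ H) 1) =
      (θ h : k) • Pi.single (g : G ⧸ H) (1 : k) := by
  set q : G ⧸ H := (g : G ⧸ H) with hq
  have hfix : (g * h * g⁻¹) • q = q := by
    rw [hq]
    change (QuotientGroup.mk (g * h * g⁻¹ * g) : G ⧸ H) = QuotientGroup.mk g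
    rw [QuotientGroup.eq, inv_mul_cancel_right, mul_inv_rev, inv_mul_cancel_right]
    exact H.inv_mem h.2
  rw [monomialRep_single, hfix]
  congr 2
  -- `q̇ = g h₀` with `h₀ ∈ H`, and `θ(h₀⁻¹ h h₀) = θ(h)`
  have hout : g⁻¹ * q.out ∈ H := by
    rw [← QuotientGroup.eq, QuotientGroup.out_eq', hq]
  have hc : monomialCocycle H (g * h * g⁻¹) q = ⟨g⁻¹ * q.out, hout⟩⁻¹ * h * ⟨g⁻¹ * q.out, hout⟩ :=
    Subtype.ext (by
      rw [coe_monomialCocycle_of_smul_eq H _ _ hfix]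
      simp only [Subgroup.coe_mul, Subgroup.coe_inv, mul_inv_rev, inv_inv]
      group)
  rw [hc, map_mul, map_mul, map_inv, inv_mul_cancel_comm]

/-- **The translates of any `e_{gH}` span `k^{G/H}`**: a submodule containing all `y · e_{gH}` is
everything (`e_{gH}` is a unit multiple of `ġ · e_H`, whose translates span,
`eq_top_of_forall_monomialRep_single_one_mem`). [cite: SerreLinearRepresentations1977, §3.3] -/
theorem eq_top_of_forall_monomialRep_single_coe_mem [DecidableEq (G ⧸ H)] [Finite (G ⧸ H)]
    (g : G) (S : Submodule k (G ⧸ H → k))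
    (hS : ∀ y : G, monomialRep H θ y (Pi.single (g : G ⧸ H) 1) ∈ S) : S = ⊤ := by
  refine eq_top_of_forall_monomialRep_single_one_mem H θ S fun y => ?_
  set q : G ⧸ H := (g : G ⧸ H)
  obtain ⟨h, hh⟩ := exists_monomialRep_out_single_one H θ q
  -- `y · e_H = θ(h) · (y q̇⁻¹) · e_{gH}`
  have h1 : monomialRep H θ y (Pi.single ((1 : G) : G ⧸ H) 1) =
      (θ h : k) • monomialRep H θ (y * q.out⁻¹) (Pi.single q 1) := by
    calc monomialRep H θ y (Pi.single ((1 : G) : G ⧸ H) 1)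
        = monomialRep H θ (y * q.out⁻¹ * q.out) (Pi.single ((1 : G) : G ⧸ H) 1) := by
          rw [inv_mul_cancel_right]
      _ = monomialRep H θ (y * q.out⁻¹) (monomialRep H θ q.out (Pi.single ((1 : G) : G ⧸ H) 1)) := by
          rw [map_mul, Module.End.mul_apply]
      _ = (θ h : k) • monomialRep H θ (y * q.out⁻¹) (Pi.single q 1) := by
          rw [hh, map_smul]
  rw [h1]
  exact S.smul_mem _ (hS _)

end Monomial

/-! ### Degree-zero Brauer induction as an isomorphism of genuine representations -/

section Rearrangement

variable {G : Type} [Group G] [Fintype G]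

/-- The direct sum `⊕_i (Ind_{H_i}^G θ_i)^{⊕ a_i}` of monomial representations with
multiplicities `a_i`, on `Π (p : Σ i, Fin (a i)), k^{G/H_{p.1}}`. [folklore] -/
abbrev sumMonomialRep {ι : Type} (H : ι → Subgroup G) (θ : ∀ i, H i →* ℂˣ) (a : ι → ℕ) :
    Representation ℂ G (∀ p : (Σ i, Fin (a i)), G ⧸ H p.1 → ℂ) :=
  Representation.pi fun p => monomialRep (H p.1) (θ p.1)

/-- `χ(⊕_i (Ind θ_i)^{a_i}) = ∑_i a_i · Ind_{H_i}^G θ_i` (`character_pi`, `character_monomialRep`).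
[cite: SerreLinearRepresentations1977, §3.3 Thm. 12] -/
theorem character_sumMonomialRep {ι : Type} [Fintype ι] (H : ι → Subgroup G) (θ : ∀ i, H i →* ℂˣ)
    (a : ι → ℕ) :
    (sumMonomialRep H θ a).character = ∑ i, (a i : ℂ) • indClassFun (H i) (fun h => (θ i h : ℂ)) := by
  rw [sumMonomialRep, Representation.character_pi]
  simp_rw [character_monomialRep]
  rw [Fintype.sum_sigma]
  refine Finset.sum_congr rfl fun i _ => ?_
  show ∑ _y : Fin (a i), indClassFun (H i) (fun h => (θ i h : ℂ)) = _
  rw [Finset.sum_const, Finset.card_univ, Fintype.card_fin, ← Nat.cast_smul_eq_nsmul ℂ]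

omit [Fintype G] in
/-- The character of the trivial representation on `k^d` is the constant `d`. [folklore] -/
theorem character_trivial_fun (d : ℕ) :
    (Representation.trivial ℂ G (Fin d → ℂ)).character = fun _ => (d : ℂ) := by
  funext g
  have h1 : Representation.trivial ℂ G (Fin d → ℂ) g = LinearMap.id :=
    LinearMap.ext fun v => Representation.trivial_apply ℂ g v
  rw [Representation.character, h1, LinearMap.trace_id, Module.finrank_fin_fun]

/-- **Degree-zero Brauer induction, as an isomorphism of representations.**  Let `π` be a
representation of the finite group `G` whose character satisfies
`χ_π - χ_π(1) = ∑_i n_i · Ind_{H_i}^G (α_i - 1)` with `n_i ∈ ℤ` (Serre, Ex. 10.6, as provided by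
`exists_sum_indClassFun_sub_one_of_isCharacter`).  Writing `n_i = a_i - b_i` (`a_i = n_i⁺`,
`b_i = n_i⁻`) and moving the negative terms across, both sides become characters of genuine
representations, which are therefore isomorphic (`Representation.nonempty_equiv_of_character_eq`):
`π ⊕ ⊕_i (Ind 1_{H_i})^{a_i} ⊕ ⊕_i (Ind α_i)^{b_i} ≅ 1^{dim π} ⊕ ⊕_i (Ind α_i)^{a_i} ⊕ ⊕_i (Ind 1_{H_i})^{b_i}`,
the `Ind`'s being monomial representations (`monomialRep`).  This is the form in which the
identity is transported to local constants (multiplicative in `⊕`).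
[cite: SerreLinearRepresentations1977, §10.5 Ex. 10.6] -/
theorem nonempty_equiv_of_character_sub_eq_sum {V : Type} [AddCommGroup V] [Module ℂ V]
    [FiniteDimensional ℂ V] (π : Representation ℂ G V) {ι : Type} [Fintype ι]
    (H : ι → Subgroup G) (α : ∀ i, H i →* ℂˣ) (n : ι → ℤ)
    (h : (fun g => π.character g - π.character 1) =
      ∑ i, (n i : ℂ) • indClassFun (H i) (fun h => (α i h : ℂ) - 1)) :
    Nonempty ((π.prod ((sumMonomialRep H (fun _ => 1) (fun i => (n i).toNat)).prod
        (sumMonomialRep H α (fun i => (-n i).toNat)))).Equiv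
      ((Representation.trivial ℂ G (Fin (finrank ℂ V) → ℂ)).prod
        ((sumMonomialRep H α (fun i => (n i).toNat)).prod
          (sumMonomialRep H (fun _ => 1) (fun i => (-n i).toNat))))) := by
  -- `Ind (α - 1) = Ind α - Ind 1`
  have hsub : ∀ i, indClassFun (H i) (fun h => (α i h : ℂ) - 1) =
      indClassFun (H i) (fun h => (α i h : ℂ)) - indClassFun (H i) (fun h => ((1 : H i →* ℂˣ) h : ℂ)) := by
    intro i
    rw [← indClassFun_sub]
    rfl
  simp_rw [hsub] at h
  refine Representation.nonempty_equiv_of_character_eq _ _ ?_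
  simp only [Representation.char_prod, character_sumMonomialRep, character_trivial_fun]
  funext g
  have key := congrFun h g
  simp only [Finset.sum_apply, Pi.smul_apply, Pi.add_apply, smul_eq_mul, Pi.sub_apply,
    Representation.char_one] at key ⊢
  have hn : ∀ i, (n i : ℂ) = ((n i).toNat : ℂ) - ((-n i).toNat : ℂ) := fun i => by
    have := Int.toNat_sub_toNat_neg (n i)
    exact_mod_cast this.symm
  have h1 : (∑ i, ((n i).toNat : ℂ) * indClassFun (H i) (fun h => (α i h : ℂ)) g +
        ∑ i, ((-n i).toNat : ℂ) * indClassFun (H i) (fun h => ((1 : H i →* ℂˣ) h : ℂ)) g) -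
      (∑ i, ((n i).toNat : ℂ) * indClassFun (H i) (fun h => ((1 : H i →* ℂˣ) h : ℂ)) g +
        ∑ i, ((-n i).toNat : ℂ) * indClassFun (H i) (fun h => (α i h : ℂ)) g) =
      ∑ i, (n i : ℂ) * (indClassFun (H i) (fun h => (α i h : ℂ)) g -
        indClassFun (H i) (fun h => ((1 : H i →* ℂˣ) h : ℂ)) g) := by
    rw [← Finset.sum_add_distrib, ← Finset.sum_add_distrib, ← Finset.sum_sub_distrib]
    refine Finset.sum_congr rfl fun i _ => ?_
    rw [hn i]
    ring
  linear_combination key - h1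

end Rearrangement

end Literature.RepresentationTheory.FiniteGroups

end
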